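import Summits.CriticalPhenomena.PercolationContinuityZ3.Theorems.PercNearOneGluingNoHeavyQuantSGCTopLowCapacity
import Summits.CriticalPhenomena.PercolationContinuityZ3.Theorems.PercNearOneGluingNoHeavyQuantGateMoveBlobGeneralWitness
import HarnessLib

/-!
# QUANT lane R8, the GRADED-CLOSURE programme (lead g37 RULING V364): the FIRST KERNEL INSTANCE OF G₀ in the light half —
# a two-layer row of (gated relay) ∗ μ from ONE top-low-capacity row of μ, with the explicit one-line certificate

builds on p205010 (kernel theorem, internal audit signed; external expert review pending)

Support file (`--supports stmt-CriticalPhenomena-4575`), QUANT lane seat prim-quant-census-2 (gen 64), rung R8 of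
`run/shared/lean/prim/quant/LADDER.md`.  Theorems with standard axioms, no sorries, default heartbeats.  Companion of `…QuantDepthOneRows` (`LawDec.TLC`),
`…QuantDepthOneClosure` (node G₀ = `LawDec.TLCGateConvTLB`), `…QuantDepthOneNotClosed` (the depth-1 closure is FALSE).  Census memo:
`run/shared/lean/prim/quant/prim-quant-census-2-g64/G0-CENSUS-G64.md` §6b.

THE REGIME.  The depth-0 node `LawDec.TLBGateConvClosed` dies exactly on products (gated relay) ∗ (big law): `μ₂ = {0: 1−y, 1: y}` and `μ₁` a
top-affordable law with all two-layer bounds but a missing top-low-capacity row (`not_tlbGateConvClosed`).  Census-2 g64's exact tensor-certificate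
oracle (memo §6) says that with the TLC rows of the big factor allowed a certificate ALWAYS exists, and that for every product row but the big factor's
top-low row it is ONE factor row with weight `1/(1−y)` on `{X₂ = 0}` and no tilts.  This file proves that one-line certificate:

**`LawDec.relayConv_twoLayerRow_of_tlcRow`.**  `0 < y < 1/2`, `u = y/(1−y)`; `μ ≥ 0` on `ℕ`; a target `T`, a threshold `d ≥ 1` of DEPTH `T − 2d ≥ 1`; `k` the
integer with `T + y − d ≤ k < T + y − d + 1` (`= ⌈T + y − d⌉`) and `k < M`.  IF `μ` satisfies the single top-low-capacity row `(j, i′) = (k, d)` at floor `y`,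
target `T` on `{0..M}` — `u·μ{≤ d} ≤ μ{k+1..M} + u·Σ_{h ≤ k, T < d+h} μ(h)/usage y T k d h` — THEN the two-layer row `d` of `ν = (gate δ₁ y) ∗ μ` at target `T + y`
holds in expanded form:  `u·((1−y)·μ{≤ d} + y·μ{≤ d−1}) ≤ (1−y)·μ{k..M} + y·μ{k−1..M}`  (`ν(n) = (1−y)μ(n) + yμ(n−1)`, `ν{≤ d}` on the left, `ν{≥ k} = ν{≥ T+y−d}` on
the right).  PROOF (memo §6b): only `h ∈ {k−1, k}` can be a mid compatible with `d` below `k` (`k − 2 < T − d`); the row gives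
`u·μ{≤d} ≤ μ{>k} + u·μ(k)/usage(d,k) + u·[T < d+k−1]·μ(k−1)/usage(d,k−1)`; and `usage ≥ u_H = (T−2d)/(d+h−T)` (`usage_mid_eq`) with
`u_H(d,k) ≥ u` ⟺ `T − 2d ≥ y(k−d)` (true: `k − d < T − 2d + y + 1`, `y < 1/2`, `T − 2d ≥ 1`; two cases `k − d = 2` / `≥ 3`) and, when `k−1` is a mid,
`u_H(d,k−1) ≥ u/y = 1/(1−y)` ⟺ `(2−y)(T−2d) ≥ k−1−d` (true: `k−1−d < T−2d+y` and `T − 2d ≥ 1 > u`).  No mean, mass or top-affordability hypothesis on `μ` is used;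
the floor enters only through `y < 1/2` (for `y ≥ 1/2` the two-layer rows alone close, arm-2 g38's Theorem A).  The excluded top row (`0 < T − 2d < 1`) is where the
certificate needs tilts / a second row (memo §6: exact LP, all cells feasible) — the genuinely two-dimensional residue of G₀ in the relay regime.
EXACT CHECK of the pointwise inequality behind this file: 4 970 / 4 970 cells (`y ∈ {1/5, 1/4, 1/3, 2/5, 9/20, 49/100}`, `M ≤ 40`, six targets per `M`, all `d`
with `T − 2d ≥ 1`); with `T − 2d < 1` it fails in 308 / 573.

[this work]; usage / flows: prim-quant-stmt g22, prim-quant-census-2 g63; the tensor principle whose `κ ≡ 0, ρ ≡ 0` instance this is: prim-quant-arm-2 g38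
(`twoLayer_pair_of_certificate`).  Nothing here is cited as a published result.  The gluing rows served [cite: KozmaNitzan2024, Conjecture 3 (p. 15)];
product measure [cite: Grimmett1999, §1.3 p. 10].
-/

noncomputable section

namespace Summit.CriticalPhenomena.PercolationContinuityZ3.Theorems

namespace Quant

open Finset

namespace LawDec

/-- **G₀ IN THE RELAY REGIME, ONE ROW AT A TIME (census-2 g64, memo §6b).**  `0 < y < 1/2`, `μ ≥ 0`; a target `T` and a threshold `1 ≤ d` with
`1 ≤ T − 2d`; `k` with `T + y − d ≤ k < T + y − d + 1` and `k < M`.  If `μ` satisfies the top-low-capacity row `(k, d)` at floor `y`, target `T` on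
`{0..M}`, then the two-layer row `d` of `(gate δ₁ y) ∗ μ` at target `T + y` holds (expanded form, see the module docstring):
`y/(1−y)·((1−y)·Σ_{n ≤ d} μ n + y·Σ_{n ≤ d−1} μ n) ≤ (1−y)·Σ_{n ≤ M}[k ≤ n] μ n + y·Σ_{n ≤ M}[k−1 ≤ n] μ n`. [this work] -/
theorem relayConv_twoLayerRow_of_tlcRow (y T : ℝ) (M d k : ℕ) (μ : ℕ → ℝ)
    (hy0 : 0 < y) (hy2 : 2 * y < 1) (hμ0 : ∀ h, 0 ≤ μ h)
    (hd : 1 ≤ d) (hs : 1 ≤ T - 2 * (d : ℝ)) (hk1 : T + y - d ≤ (k : ℝ)) (hk2 : (k : ℝ) < T + y - d + 1) (hkM : k < M)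
    (hrow : y / (1 - y) * ∑ l ∈ Finset.range (d + 1), μ l
      ≤ ∑ h ∈ Finset.range (M + 1), (if k + 1 ≤ h then μ h else 0)
        + y / (1 - y) * ∑ h ∈ Finset.range (M + 1),
            (if h ≤ k ∧ T < (d : ℝ) + h then μ h / usage y T k d h else 0)) :
    y / (1 - y) * ((1 - y) * ∑ n ∈ Finset.range (d + 1), μ n + y * ∑ n ∈ Finset.range d, μ n)
      ≤ (1 - y) * ∑ n ∈ Finset.range (M + 1), (if k ≤ n then μ n else 0)
        + y * ∑ n ∈ Finset.range (M + 1), (if k - 1 ≤ n then μ n else 0) := by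
  classical
  have hy1 : y < 1 := by linarith
  have h1y : 0 < 1 - y := by linarith
  set u : ℝ := y / (1 - y) with hu
  have hu0 : 0 < u := div_pos hy0 h1y
  have hu1 : u < 1 := by rw [hu, div_lt_one h1y]; linarith
  -- integer bookkeeping: d + 2 ≤ k (since k ≥ T + y - d > d + 1 + y... from T - 2d ≥ 1)
  have hkd : d + 2 ≤ k := by
    have : (d : ℝ) + 1 < k := by linarith
    have h' : d + 1 < k := by exact_mod_cast this
    omega
  have hk0 : 1 ≤ k := by omega
  have hkM' : k < M + 1 := by omega
  have hlow : 2 * (d : ℝ) < T := by linarith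
  -- (1) split the giant sums:  Σ[k ≤ n] = μ k + Σ[k+1 ≤ n],  Σ[k-1 ≤ n] = μ (k-1) + μ k + Σ[k+1 ≤ n]
  have hGk : ∑ n ∈ Finset.range (M + 1), (if k ≤ n then μ n else 0)
      = μ k + ∑ n ∈ Finset.range (M + 1), (if k + 1 ≤ n then μ n else 0) := by
    have e : ∀ n ∈ Finset.range (M + 1), (if k ≤ n then μ n else 0)
        = (if n = k then μ n else 0) + (if k + 1 ≤ n then μ n else 0) := by
      intro n _
      by_cases h1 : n = k
      · subst h1; simp
      · by_cases h2 : k + 1 ≤ n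
        · rw [if_pos (by omega), if_neg h1, if_pos h2, zero_add]
        · rw [if_neg (by omega), if_neg h1, if_neg h2, zero_add]
    rw [Finset.sum_congr rfl e, Finset.sum_add_distrib, Finset.sum_ite_eq' (Finset.range (M + 1)) k,
      if_pos (Finset.mem_range.2 hkM')]
  have hGk1 : ∑ n ∈ Finset.range (M + 1), (if k - 1 ≤ n then μ n else 0)
      = μ (k - 1) + (μ k + ∑ n ∈ Finset.range (M + 1), (if k + 1 ≤ n then μ n else 0)) := by
    rw [← hGk]
    have e : ∀ n ∈ Finset.range (M + 1), (if k - 1 ≤ n then μ n else 0)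
        = (if n = k - 1 then μ n else 0) + (if k ≤ n then μ n else 0) := by
      intro n _
      by_cases h1 : n = k - 1
      · subst h1; rw [if_pos le_rfl, if_pos rfl, if_neg (by omega), add_zero]
      · by_cases h2 : k ≤ n
        · rw [if_pos (by omega), if_neg h1, if_pos h2, zero_add]
        · rw [if_neg (by omega), if_neg h1, if_neg h2, zero_add]
    rw [Finset.sum_congr rfl e, Finset.sum_add_distrib, Finset.sum_ite_eq' (Finset.range (M + 1)) (k - 1),
      if_pos (Finset.mem_range.2 (by omega))]
  -- (2) the capacity sum has only the terms h = k and (possibly) h = k - 1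
  have hcap : ∑ h ∈ Finset.range (M + 1), (if h ≤ k ∧ T < (d : ℝ) + h then μ h / usage y T k d h else 0)
      = μ k / usage y T k d k + (if T < (d : ℝ) + ((k - 1 : ℕ) : ℝ) then μ (k - 1) / usage y T k d (k - 1) else 0) := by
    have e : ∀ h ∈ Finset.range (M + 1), (if h ≤ k ∧ T < (d : ℝ) + h then μ h / usage y T k d h else 0)
        = (if h = k then μ h / usage y T k d h else 0)
          + (if h = k - 1 then (if T < (d : ℝ) + ((k - 1 : ℕ) : ℝ) then μ (k - 1) / usage y T k d (k - 1) else 0) else 0) := by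
      intro h _
      by_cases h1 : h = k
      · subst h1
        have hc : T < (d : ℝ) + h := by linarith
        rw [if_pos ⟨le_rfl, hc⟩, if_pos rfl, if_neg (by omega), add_zero]
      · by_cases h2 : h = k - 1
        · subst h2
          rw [if_neg h1, if_pos rfl, zero_add]
          by_cases hc : T < (d : ℝ) + ((k - 1 : ℕ) : ℝ)
          · rw [if_pos ⟨by omega, hc⟩, if_pos hc]
          · rw [if_neg (fun h' => hc h'.2), if_neg hc]
        · -- h ≤ k - 2 or h > k: no contribution
          rw [if_neg h1, if_neg h2, add_zero, if_neg]
          rintro ⟨hle, hc⟩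
          have hle2 : h + 2 ≤ k := by omega
          have : (h : ℝ) + 2 ≤ k := by exact_mod_cast hle2
          linarith
    rw [Finset.sum_congr rfl e, Finset.sum_add_distrib, Finset.sum_ite_eq' (Finset.range (M + 1)) k,
      if_pos (Finset.mem_range.2 hkM'), Finset.sum_ite_eq' (Finset.range (M + 1)) (k - 1),
      if_pos (Finset.mem_range.2 (by omega))]
  -- (3) the left side: u((1-y)A_d + yA_{d-1}) = u A_d - u y μ d
  have hA : ∑ n ∈ Finset.range (d + 1), μ n = ∑ n ∈ Finset.range d, μ n + μ d := Finset.sum_range_succ _ _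
  -- (4) condition (i): usage(d, k) ≥ u, i.e. heavy rate (T-2d)/(d+k-T) ≥ u
  have hcompk : T < (d : ℝ) + k := by linarith
  have hki : u ≤ usage y T k d k := by
    refine le_trans ?_ (heavy_le_usage y T k d k hy0 hy1 le_rfl hlow hcompk)
    -- u ≤ (T-2d)/(d+k-T)  ⟸  y (d + k - T) ≤ (1-y)(T - 2d)  ⟸  y (k - d) ≤ T - 2d
    have hden : 0 < (d : ℝ) + k - T := by linarith
    rw [hu, div_le_div_iff₀ h1y hden]
    -- case split on k - d = 2 or ≥ 3
    rcases Nat.lt_or_ge k (d + 3) with hlt | hge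
    · have hkeq : k = d + 2 := by omega
      have : (k : ℝ) = d + 2 := by rw [hkeq]; push_cast; ring
      rw [this]; nlinarith
    · have : (d : ℝ) + 3 ≤ k := by exact_mod_cast hge
      nlinarith
  -- (5) condition (ii): if k - 1 is a mid then usage(d, k-1) ≥ u / y = 1/(1-y)
  have hkii : T < (d : ℝ) + ((k - 1 : ℕ) : ℝ) → u / y ≤ usage y T k d (k - 1) := by
    intro hc
    refine le_trans ?_ (heavy_le_usage y T k d (k - 1) hy0 hy1 (by omega) hlow hc)
    have hden : 0 < (d : ℝ) + ((k - 1 : ℕ) : ℝ) - T := by linarith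
    have huy : u / y = 1 / (1 - y) := by rw [hu]; field_simp
    rw [huy, div_le_div_iff₀ h1y hden]
    have hk' : (((k - 1 : ℕ) : ℝ)) = (k : ℝ) - 1 := by
      rw [Nat.cast_sub hk0]; push_cast; ring
    rw [hk'] at hc ⊢
    nlinarith
  -- (6) assemble
  have hμk : 0 ≤ μ k := hμ0 k
  have hμk1 : 0 ≤ μ (k - 1) := hμ0 (k - 1)
  have hμd : 0 ≤ μ d := hμ0 d
  have hupos : 0 < usage y T k d k := lt_of_lt_of_le hu0 hki
  -- u μ k / usage(d,k) ≤ μ k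
  have hT1 : u * (μ k / usage y T k d k) ≤ μ k := by
    have := div_le_div_of_nonneg_left hμk hu0 hki
    calc u * (μ k / usage y T k d k) ≤ u * (μ k / u) := mul_le_mul_of_nonneg_left this hu0.le
      _ = μ k := by field_simp
  -- u [mid] μ (k-1) / usage(d,k-1) ≤ y μ (k-1)
  have hT2 : u * (if T < (d : ℝ) + ((k - 1 : ℕ) : ℝ) then μ (k - 1) / usage y T k d (k - 1) else 0) ≤ y * μ (k - 1) := by
    split_ifs with hc
    · have huy0 : 0 < u / y := div_pos hu0 hy0
      have := div_le_div_of_nonneg_left hμk1 huy0 (hkii hc)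
      calc u * (μ (k - 1) / usage y T k d (k - 1)) ≤ u * (μ (k - 1) / (u / y)) := mul_le_mul_of_nonneg_left this hu0.le
        _ = y * μ (k - 1) := by field_simp
    · rw [mul_zero]; exact mul_nonneg hy0.le hμk1
  rw [hcap] at hrow
  rw [hGk, hGk1, hA]
  have hsplit : u * ((1 - y) * (∑ n ∈ Finset.range d, μ n + μ d) + y * ∑ n ∈ Finset.range d, μ n)
      = u * (∑ n ∈ Finset.range d, μ n + μ d) - u * y * μ d := by ring
  rw [hsplit]
  rw [hA] at hrow
  nlinarith [mul_nonneg hu0.le (mul_nonneg hy0.le hμd), hrow, hT1, hT2, mul_add u (μ k / usage y T k d k)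
    (if T < (d : ℝ) + ((k - 1 : ℕ) : ℝ) then μ (k - 1) / usage y T k d (k - 1) else 0)]

/-! ## Appendix (same seat, same session): the gated relay with an INTERIOR gate `g ≥ y` -/

/-- **G₀ IN THE RELAY REGIME, interior gate.**  As `relayConv_twoLayerRow_of_tlcRow` but for the partner `{0: 1−g, 1: g}` with any gate `y ≤ g < 1`
(the relay's marginal may exceed the floor): the certificate weight becomes `1/(1−g)` and the two rate conditions are taken as hypotheses in closed
form — `y·(k − d) ≤ T − 2d` (the mid `k` absorbs at rate `≥ u`; automatic for `g = y`, `T − 2d ≥ 1`, `y < 1/2`, and for any `g` once `T − 2d ≥ 2`) and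
`y/(1−y) ≤ T − 2d` (the mid `k − 1`, if compatible, absorbs at rate `≥ u/g`).  Conclusion: the two-layer row `d` of `(gate δ₁ g) ∗ μ` at target `T + g`,
`y/(1−y)·((1−g)·Σ_{n ≤ d} μ n + g·Σ_{n ≤ d−1} μ n) ≤ (1−g)·Σ_{n ≤ M}[k ≤ n] μ n + g·Σ_{n ≤ M}[k−1 ≤ n] μ n`.  (Exact check of the zero-tilt single-row
certificate family behind it: memo §6b, 1 880 / 1 880 deep rows for `g ∈ {1.2, 1.5, 2}·y`.) [this work] -/
theorem gateRelayConv_twoLayerRow_of_tlcRow (y g T : ℝ) (M d k : ℕ) (μ : ℕ → ℝ)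
    (hy0 : 0 < y) (hy1 : y < 1) (hgy : y ≤ g) (hg1 : g < 1) (hμ0 : ∀ h, 0 ≤ μ h)
    (hd : 1 ≤ d) (hk1 : T + g - d ≤ (k : ℝ)) (hk2 : (k : ℝ) < T + g - d + 1) (hkM : k < M)
    (hrate : y * ((k : ℝ) - d) ≤ T - 2 * (d : ℝ)) (hdepth : y / (1 - y) ≤ T - 2 * (d : ℝ))
    (hrow : y / (1 - y) * ∑ l ∈ Finset.range (d + 1), μ l
      ≤ ∑ h ∈ Finset.range (M + 1), (if k + 1 ≤ h then μ h else 0)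
        + y / (1 - y) * ∑ h ∈ Finset.range (M + 1),
            (if h ≤ k ∧ T < (d : ℝ) + h then μ h / usage y T k d h else 0)) :
    y / (1 - y) * ((1 - g) * ∑ n ∈ Finset.range (d + 1), μ n + g * ∑ n ∈ Finset.range d, μ n)
      ≤ (1 - g) * ∑ n ∈ Finset.range (M + 1), (if k ≤ n then μ n else 0)
        + g * ∑ n ∈ Finset.range (M + 1), (if k - 1 ≤ n then μ n else 0) := by
  classical
  have h1y : 0 < 1 - y := by linarith
  set u : ℝ := y / (1 - y) with hu
  have hu0 : 0 < u := div_pos hy0 h1y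
  have hg0 : 0 < g := lt_of_lt_of_le hy0 hgy
  -- integer bookkeeping: d + 2 ≤ k  (k ≥ T + g - d = (T - 2d) + d + g ≥ u + d + g > d + 1 is not automatic; use k > T + g - d - 1 + ... :
  -- from hdepth: T - 2d ≥ u > 0 and hk1: k ≥ T - 2d + d + g > d + g > d, and y(k-d) ≤ T - 2d with ... we only need k ≥ d + 1 and k ≥ 1)
  have hkd : d + 1 ≤ k := by
    have : (d : ℝ) < k := by nlinarith
    have h' : d < k := by exact_mod_cast this
    omega
  have hk0 : 1 ≤ k := by omega
  have hkM' : k < M + 1 := by omega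
  have hlow : 2 * (d : ℝ) < T := by nlinarith
  have hGk : ∑ n ∈ Finset.range (M + 1), (if k ≤ n then μ n else 0)
      = μ k + ∑ n ∈ Finset.range (M + 1), (if k + 1 ≤ n then μ n else 0) := by
    have e : ∀ n ∈ Finset.range (M + 1), (if k ≤ n then μ n else 0)
        = (if n = k then μ n else 0) + (if k + 1 ≤ n then μ n else 0) := by
      intro n _
      by_cases h1 : n = k
      · subst h1; simp
      · by_cases h2 : k + 1 ≤ n
        · rw [if_pos (by omega), if_neg h1, if_pos h2, zero_add]
        · rw [if_neg (by omega), if_neg h1, if_neg h2, zero_add]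
    rw [Finset.sum_congr rfl e, Finset.sum_add_distrib, Finset.sum_ite_eq' (Finset.range (M + 1)) k,
      if_pos (Finset.mem_range.2 hkM')]
  have hGk1 : ∑ n ∈ Finset.range (M + 1), (if k - 1 ≤ n then μ n else 0)
      = μ (k - 1) + (μ k + ∑ n ∈ Finset.range (M + 1), (if k + 1 ≤ n then μ n else 0)) := by
    rw [← hGk]
    have e : ∀ n ∈ Finset.range (M + 1), (if k - 1 ≤ n then μ n else 0)
        = (if n = k - 1 then μ n else 0) + (if k ≤ n then μ n else 0) := by
      intro n _
      by_cases h1 : n = k - 1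
      · subst h1; rw [if_pos le_rfl, if_pos rfl, if_neg (by omega), add_zero]
      · by_cases h2 : k ≤ n
        · rw [if_pos (by omega), if_neg h1, if_pos h2, zero_add]
        · rw [if_neg (by omega), if_neg h1, if_neg h2, zero_add]
    rw [Finset.sum_congr rfl e, Finset.sum_add_distrib, Finset.sum_ite_eq' (Finset.range (M + 1)) (k - 1),
      if_pos (Finset.mem_range.2 (by omega))]
  -- the capacity sum: only h = k and h = k - 1 (h ≤ k - 2 has d + h ≤ k - 2 + d < T since k < T + g - d + 1 ≤ T - d + 2)
  have hcap : ∑ h ∈ Finset.range (M + 1), (if h ≤ k ∧ T < (d : ℝ) + h then μ h / usage y T k d h else 0)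
      = (if T < (d : ℝ) + k then μ k / usage y T k d k else 0)
        + (if T < (d : ℝ) + ((k - 1 : ℕ) : ℝ) then μ (k - 1) / usage y T k d (k - 1) else 0) := by
    have e : ∀ h ∈ Finset.range (M + 1), (if h ≤ k ∧ T < (d : ℝ) + h then μ h / usage y T k d h else 0)
        = (if h = k then (if T < (d : ℝ) + k then μ k / usage y T k d k else 0) else 0)
          + (if h = k - 1 then (if T < (d : ℝ) + ((k - 1 : ℕ) : ℝ) then μ (k - 1) / usage y T k d (k - 1) else 0) else 0) := by
      intro h _
      by_cases h1 : h = k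
      · subst h1
        rw [if_pos (show h = h from rfl), if_neg (show ¬ (h = h - 1) by omega), add_zero]
        by_cases hc : T < (d : ℝ) + h
        · rw [if_pos ⟨le_rfl, hc⟩, if_pos hc]
        · rw [if_neg (fun h' => hc h'.2), if_neg hc]
      · by_cases h2 : h = k - 1
        · subst h2
          rw [if_neg h1, if_pos rfl, zero_add]
          by_cases hc : T < (d : ℝ) + ((k - 1 : ℕ) : ℝ)
          · rw [if_pos ⟨by omega, hc⟩, if_pos hc]
          · rw [if_neg (fun h' => hc h'.2), if_neg hc]
        · rw [if_neg h1, if_neg h2, add_zero, if_neg]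
          rintro ⟨hle, hc⟩
          have hle2 : h + 2 ≤ k := by omega
          have : (h : ℝ) + 2 ≤ k := by exact_mod_cast hle2
          linarith
    rw [Finset.sum_congr rfl e, Finset.sum_add_distrib, Finset.sum_ite_eq' (Finset.range (M + 1)) k,
      if_pos (Finset.mem_range.2 hkM'), Finset.sum_ite_eq' (Finset.range (M + 1)) (k - 1),
      if_pos (Finset.mem_range.2 (by omega))]
  have hA : ∑ n ∈ Finset.range (d + 1), μ n = ∑ n ∈ Finset.range d, μ n + μ d := Finset.sum_range_succ _ _
  have hμk : 0 ≤ μ k := hμ0 k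
  have hμk1 : 0 ≤ μ (k - 1) := hμ0 (k - 1)
  have hμd : 0 ≤ μ d := hμ0 d
  -- the mid k: usage ≥ heavy rate ≥ u
  have hT1 : u * (if T < (d : ℝ) + k then μ k / usage y T k d k else 0) ≤ μ k := by
    split_ifs with hc
    · have hki : u ≤ usage y T k d k := by
        refine le_trans ?_ (heavy_le_usage y T k d k hy0 hy1 le_rfl hlow hc)
        have hden : 0 < (d : ℝ) + k - T := by linarith
        rw [hu, div_le_div_iff₀ h1y hden]
        nlinarith
      have := div_le_div_of_nonneg_left hμk hu0 hki
      calc u * (μ k / usage y T k d k) ≤ u * (μ k / u) := mul_le_mul_of_nonneg_left this hu0.le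
        _ = μ k := by field_simp
    · rw [mul_zero]; exact hμk
  -- the mid k - 1: usage ≥ heavy rate ≥ u / g
  have hT2 : u * (if T < (d : ℝ) + ((k - 1 : ℕ) : ℝ) then μ (k - 1) / usage y T k d (k - 1) else 0) ≤ g * μ (k - 1) := by
    split_ifs with hc
    · have huy0 : 0 < u / g := div_pos hu0 hg0
      have hkii : u / g ≤ usage y T k d (k - 1) := by
        refine le_trans ?_ (heavy_le_usage y T k d (k - 1) hy0 hy1 (by omega) hlow hc)
        have hden : 0 < (d : ℝ) + ((k - 1 : ℕ) : ℝ) - T := by linarith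
        rw [hu, div_div, div_le_div_iff₀ (mul_pos h1y hg0) hden]
        have hk' : (((k - 1 : ℕ) : ℝ)) = (k : ℝ) - 1 := by
          rw [Nat.cast_sub hk0]; push_cast; ring
        rw [hk'] at hc ⊢
        -- y (d + (k-1) - T) ≤ (T - 2d)(1-y) g :  d + k - 1 - T < g, and (T-2d)(1-y) ≥ y
        have h1 : (d : ℝ) + ((k : ℝ) - 1) - T < g := by linarith
        have h2 : y ≤ (T - 2 * (d : ℝ)) * (1 - y) := by
          rw [hu, div_le_iff₀ h1y] at hdepth; linarith
        nlinarith [mul_le_mul_of_nonneg_left h1.le hy0.le, mul_le_mul_of_nonneg_right h2 hg0.le]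
      have := div_le_div_of_nonneg_left hμk1 huy0 hkii
      calc u * (μ (k - 1) / usage y T k d (k - 1)) ≤ u * (μ (k - 1) / (u / g)) := mul_le_mul_of_nonneg_left this hu0.le
        _ = g * μ (k - 1) := by field_simp
    · rw [mul_zero]; exact mul_nonneg hg0.le hμk1
  rw [hcap] at hrow
  rw [hGk, hGk1, hA]
  have hsplit : u * ((1 - g) * (∑ n ∈ Finset.range d, μ n + μ d) + g * ∑ n ∈ Finset.range d, μ n)
      = u * (∑ n ∈ Finset.range d, μ n + μ d) - u * g * μ d := by ring
  rw [hsplit]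
  rw [hA] at hrow
  nlinarith [mul_nonneg hu0.le (mul_nonneg hg0.le hμd), hrow, hT1, hT2,
    mul_add u (if T < (d : ℝ) + k then μ k / usage y T k d k else 0)
      (if T < (d : ℝ) + ((k - 1 : ℕ) : ℝ) then μ (k - 1) / usage y T k d (k - 1) else 0)]

end LawDec

end Quant

end Summit.CriticalPhenomena.PercolationContinuityZ3.Theorems
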